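import Summits.HodgeConjecture.HodgeConjecture.Theorems.F0P6aSpecOrgansU
import HarnessLib
import HarnessLib.Audit.LibrarySuggestionsDenyListCruxes

/-!
# F0_P6a_SpecOrgansU — ED. 3 = SHIM (K6 L2 column re-home; pen LA2-plan (g5) PLAN «L2 cone RE-HOME» v1.4; ★ parts = LA2-p02 (g5)՚s R3 cut set, filed by LA2-p01 (g6) (DEAL 11); box LAref-D first ∕ LA-ref1 second; TEMPLATE by LA2-p03 (g7) v1tmpl 2e9a89b1, re-trued by the pen)

Every declaration of the tree workfile `Lines/F0_P6a_SpecOrgansU.lean` (ED. 2, sha16 c0cd5fc2e87636d7, 1348 l., sorry-free, stub-free; 23 declarations = 22 theorems + 1 def-like: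
`isReduced_total_of_isSmoothProper`, `hD_of_inputs`, `isIdealTorsionΩ_one`, `isIdealTorsionΩ_mul`, `isIdealTorsionΩ_inv`, `imgLineOfRoof`, `mem_imgLineOfRoof_iff`, `imgLineOfRoof_isLine`, `eq_of_roofΩ_of_roofΩ`, `exists_imgLine_quotΩ_quotΩ_eq_translΩ`, …, last head `imgLine_quotΩ_quotΩ_eq_translΩ_assembled`)
now lives, byte for byte and under the SAME namespace `Summit.HodgeConjecture.HodgeConjecture.Cruxes.HLiu418.F0P6aLineSpecialisation`, in the ★ chain
★ `Theorems/F0P6aSpecOrgansUBlockJ.lean` (p853366) → ★ `Theorems/F0P6aSpecOrgansURoofKernelUnique.lean` (p853396) → ★ `Theorems/F0P6aSpecOrgansUTwoRoofLegs.lean` (p853409) → ★ `Theorems/F0P6aSpecOrgansURoofFlat.lean` (p853428) → ★ `Theorems/F0P6aSpecOrgansU.lean` (p853450) (LAST part = plain stem; each part imports the previous); this module keeps its name so that its tree importers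
(`Lines/F0_P6a_StubRHO1.lean`) and any by-name reader under `open …F0P6aLineSpecialisation` resolve unchanged through the import above.
It declares nothing.  ONE declaration changed FORM in the ★ twin, none was lost: `hD_of_inputs` (tree :82, a by-copy twin of ★ `Summit.HodgeConjecture.HodgeConjecture.Cruxes.HLiu418.F0P6aStubFROBRoofGeoWiring.nonempty_unitHatSlice_iso_of_inputs`,
`Theorems/F0P6aStubFROBRoofGeoWiringAdapters.lean`, which landed first ⇒ gate `dedup.landed`) is carried by ★ part 1 as `alias hD_of_inputs := …F0P6aStubFROBRoofGeoWiring.nonempty_unitHatSlice_iso_of_inputs`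
(«M-142h» (iii′), pen RULING R3 P1 (β′) 02:02:52Z 09-03; statement and `variable` frame token-identical) — the FQN `…F0P6aLineSpecialisation.hD_of_inputs` is therefore PRESENT ★-side and its readers
(`Lines/F0_P6a_StubRHO1.lean` :1582, ★ `Theorems/F0P6aStubRHO1.lean`) resolve unchanged; the other 22 are verbatim ⇒ nothing else to alias, CLOSURE-NAMES ∅.
ORDER NOTE: written under the standing wave rule («M-150») after EVERY ★ part above is ACCEPTED and served (NO-CROSS-IMPORT: no environment may hold
a `Lines/` ORIGINAL of this column together with its ★ twin); an importer smoke that reads «environment already contains …» before the wave՚s request is BUILT is this order note,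
not a defect.  Edition history stays in the line card `Lines/F0_P6a_SpecOrgansU.md` and in git; future changes are ★-side proposals on the `Theorems/` files.
HC_CM is proved only modulo the 7 printed citations (2 remaining named inputs: hLiu418 = stmt-HodgeConjecture-24832, h413 = stmt-HodgeConjecture-24833) until rung 0 closes; count-neutral (0 `sorry`, 0 socket, 0 declarations). -/
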